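import Summits.HodgeConjecture.CorCM.IrreducibleOddWeightsCommutantDomination
import Summits.HodgeConjecture.CorCM.IrreducibleOddWeightsIsotypicSplittingFamilies
import Summits.HodgeConjecture.CorCM.IrreducibleOddWeightsCommutantDensityCMFields
import HarnessLib

/-!
# Density over the commutant, XII: HODGE DOMINATION IS DECIDED CLASS BY CLASS —
# `S(Σ_c p¹_c) ≤ S(Σ_c p⁰_c)` IFF `S(p¹_c) ≤ S(p⁰_c)` for every isotypic class `c`

COR-CM (cell `pub-hodgecm2`, binder seat `b16` gen 73, count-neutral claim THE BICOMMUTANT AND HODGE DOMINATION,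
file K6 — abstract `G`-set level, type ranks, CM fields; theorems only, no definition, no named fact, no `sorry`).
NEW as stated, hence under `Summits/`.  HONEST FRAMING: gen 70's file I11 (the meet of two shadow-coefficient spaces
SPLITS over the isotypic classes and the dimensions add) turned into a CONTAINMENT criterion by a dimension count,
then read through file K3: the pair `A₀ × A₁` is Hodge-dominated by `A₀` (`dim MT(A₀ × A₁) = dim MT(A₀)`) iff,
CLASS BY CLASS, the coefficient space of the class component of the type vector `u₁` lies in that of the class
component of the shadow `w₀` — and inside one class that is file K3's `D⟨b′⟩ ≤ D⟨b⟩` (file C6).  This removes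
file K3 §3's restriction to shadows lying in ONE isotypic class.  Linear algebra of translates on finite `G`-sets and
its reading for CM abelian varieties; `HC_CM` is neither used nor asserted.

SETTING (file I11).  On each pivot a finite family of stable irreducible constituents `A⁰_j ≤ ℚ^{Y₀}`,
`A¹_j ≤ ℚ^{Y₁}` with CLASS LABELS `c₀ j`, `c₁ j ∈ C` such that no non-zero constituent embeds equivariantly into
one with a different label; class components `p⁰_c ∈ Σ_{c₀ j = c} A⁰_j`, `p¹_c ∈ Σ_{c₁ j = c} A¹_j`;
`S(w) = span{g ↦ w(g·y)} ≤ ℚ^G`.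

* §1 **CONTAINMENT SPLITS OVER THE CLASSES** (`span_shadowCoeff_sum_le_iff_forall_of_classes`):
  **`S(Σ_c p¹_c) ≤ S(Σ_c p⁰_c) ⟺ ∀ c, S(p¹_c) ≤ S(p⁰_c)`** — I11 gives `dim(S(w₀) ∩ S(w₁)) = Σ_c dim(S(p⁰_c) ∩
  S(p¹_c))` and (applied to `(w₁, w₁)`) `dim S(w₁) = Σ_c dim S(p¹_c)`; containment is `dim(S(w₀) ∩ S(w₁)) = dim
  S(w₁)`, and a sum of termwise inequalities is an equality iff every term is.  Equality form
  `span_shadowCoeff_sum_eq_iff_forall_of_classes`.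
* §2 TYPE RANKS (`typeRank_sigmaType_eq_typeRank_iff_forall_of_classes`): slot `0` with an equivariant pivot
  `r₀ : E₀ → Y₀` refining the trace classes and shadow `w₀ = Σ_c p⁰_c`, slot `1` with its type vector
  `u₁ = Σ_c p¹_c` (Galois pivot `Y₁ = E₁`): **`rank(Φ₀,Φ₁) = rank Φ₀ ⟺ ∀ c, S(p¹_c) ≤ S(p⁰_c)`**; in each class met
  by `u₁` and assembled from a reference irreducible with commutant `𝒟_c`, `S(p¹_c) ≤ S(p⁰_c)` is file C6's
  `D_c⟨b′_c⟩ ≤ D_c⟨b_c⟩` (`span_shadowCoeff_le_iff_iSup_le`); a class met by `u₁` but NOT by `w₀` (`p⁰_c = 0`,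
  `p¹_c ≠ 0`) forbids domination (`not_span_shadowCoeff_le_of_ne_zero_of_eq_zero`).
* §3 CM dress (`cmFamilyRank_eq_cmTypeRank_iff_forall_of_classes`): for a trace subfield `T₀ ⊆ K_{i₀}` (TR),
  **`dim MT(A₀ × A₁) = dim MT(A₀) ⟺ ∀ c, S(p¹_c) ≤ S(p⁰_c)`**.

## References

* [Serre1977] J.-P. Serre, *Linear Representations of Finite Groups*, GTM 42, §2.6 (canonical decomposition).
* [Gordon1999HodgeAVSurvey] B. B. Gordon, *A survey of the Hodge conjecture for abelian varieties*, §3 Theorem (proof),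
  7.5–7.7, 9.4.3.
* [Deligne1982HodgeCycles] P. Deligne, *Hodge cycles on abelian varieties*, LNM 900 (1982), I.5 (p. 53), I Ex. 3.7.
* [Lang2002] S. Lang, *Algebra*, 3rd ed., XVII §2–§3.
-/

set_option autoImplicit false

noncomputable section

open scoped BigOperators Classical

universe u u' u₀ u₁ v v' v'' vY w

namespace Summit.HodgeConjecture.CorCM.IrrOdd

open Literature.NumberTheory.ComplexMultiplication

variable {G : Type w} [Group G] {Y₀ : Type v'} [MulAction G Y₀] [Fintype Y₀]
  {Y₁ : Type v''} [MulAction G Y₁] [Fintype Y₁]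

/-! ### §1 Containment splits over the classes -/

/-- **CONTAINMENT SPLITS OVER THE ISOTYPIC CLASSES: `S(Σ_c p¹_c) ≤ S(Σ_c p⁰_c) ⟺ ∀ c, S(p¹_c) ≤ S(p⁰_c)`** for
class components of labelled families of stable irreducible constituents with no equivariant embedding across
different labels (file I11's setting). [cite: Serre1977, §2.6] [cite: Lang2002, XVII §3]
[cite: Gordon1999HodgeAVSurvey, §3 Theorem (proof), 7.5–7.7] -/
theorem span_shadowCoeff_sum_le_iff_forall_of_classes {C : Type u} [Fintype C] {J₀ : Type u₀} {J₁ : Type u₁}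
    [Fintype J₀] [Fintype J₁] (c₀ : J₀ → C) (c₁ : J₁ → C)
    {A₀ : J₀ → Submodule ℚ (Y₀ → ℚ)} {A₁ : J₁ → Submodule ℚ (Y₁ → ℚ)}
    (hA₀st : ∀ (j : J₀) (k : G) (a : Y₀ → ℚ), a ∈ A₀ j → (fun y => a (k • y)) ∈ A₀ j)
    (hA₀irr : ∀ (j : J₀) (W : Submodule ℚ (Y₀ → ℚ)), W ≤ A₀ j → W ≠ ⊥ →
      (∀ (k : G) (f : Y₀ → ℚ), f ∈ W → (fun y => f (k • y)) ∈ W) → W = A₀ j)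
    (hA₁st : ∀ (j : J₁) (k : G) (a : Y₁ → ℚ), a ∈ A₁ j → (fun y => a (k • y)) ∈ A₁ j)
    (hA₁irr : ∀ (j : J₁) (W : Submodule ℚ (Y₁ → ℚ)), W ≤ A₁ j → W ≠ ⊥ →
      (∀ (k : G) (f : Y₁ → ℚ), f ∈ W → (fun y => f (k • y)) ∈ W) → W = A₁ j)
    (h₀₀ : ∀ (j k : J₀) (L : (Y₀ → ℚ) →ₗ[ℚ] (Y₀ → ℚ)), c₀ j ≠ c₀ k → A₀ j ≠ ⊥ → (∀ a ∈ A₀ j, L a ∈ A₀ k) →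
      (∀ a ∈ A₀ j, L a = 0 → a = 0) → (∀ (g : G) (a : Y₀ → ℚ), a ∈ A₀ j →
        L (fun y => a (g • y)) = fun y => L a (g • y)) → False)
    (h₀₁ : ∀ (j : J₀) (k : J₁) (L : (Y₀ → ℚ) →ₗ[ℚ] (Y₁ → ℚ)), c₀ j ≠ c₁ k → A₀ j ≠ ⊥ → (∀ a ∈ A₀ j, L a ∈ A₁ k) →
      (∀ a ∈ A₀ j, L a = 0 → a = 0) → (∀ (g : G) (a : Y₀ → ℚ), a ∈ A₀ j →
        L (fun y => a (g • y)) = fun y => L a (g • y)) → False)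
    (h₁₀ : ∀ (j : J₁) (k : J₀) (L : (Y₁ → ℚ) →ₗ[ℚ] (Y₀ → ℚ)), c₁ j ≠ c₀ k → A₁ j ≠ ⊥ → (∀ a ∈ A₁ j, L a ∈ A₀ k) →
      (∀ a ∈ A₁ j, L a = 0 → a = 0) → (∀ (g : G) (a : Y₁ → ℚ), a ∈ A₁ j →
        L (fun y => a (g • y)) = fun y => L a (g • y)) → False)
    (h₁₁ : ∀ (j k : J₁) (L : (Y₁ → ℚ) →ₗ[ℚ] (Y₁ → ℚ)), c₁ j ≠ c₁ k → A₁ j ≠ ⊥ → (∀ a ∈ A₁ j, L a ∈ A₁ k) →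
      (∀ a ∈ A₁ j, L a = 0 → a = 0) → (∀ (g : G) (a : Y₁ → ℚ), a ∈ A₁ j →
        L (fun y => a (g • y)) = fun y => L a (g • y)) → False)
    {p₀ : C → (Y₀ → ℚ)} {p₁ : C → (Y₁ → ℚ)}
    (hp₀ : ∀ c, p₀ c ∈ ⨆ j : {j // c₀ j = c}, A₀ j.1) (hp₁ : ∀ c, p₁ c ∈ ⨆ j : {j // c₁ j = c}, A₁ j.1) :
    Submodule.span ℚ (Set.range fun y : Y₁ => fun g : G => (∑ c, p₁ c) (g • y)) ≤
        Submodule.span ℚ (Set.range fun y : Y₀ => fun g : G => (∑ c, p₀ c) (g • y)) ↔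
      ∀ c, Submodule.span ℚ (Set.range fun y : Y₁ => fun g : G => p₁ c (g • y)) ≤
        Submodule.span ℚ (Set.range fun y : Y₀ => fun g : G => p₀ c (g • y)) := by
  -- the meet splits (I11), and so does `S(w₁) = S(w₁) ∩ S(w₁)`
  have hmeet := finrank_span_shadowCoeff_sum_inf_eq_sum_of_classes c₀ c₁ hA₀st hA₀irr hA₁st hA₁irr h₀₀ h₀₁ h₁₀ h₁₁
    hp₀ hp₁
  have hself := finrank_span_shadowCoeff_sum_inf_eq_sum_of_classes c₁ c₁ hA₁st hA₁irr hA₁st hA₁irr h₁₁ h₁₁ h₁₁ h₁₁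
    hp₁ hp₁
  rw [inf_idem] at hself
  replace hself : Module.finrank ℚ
      ↥(Submodule.span ℚ (Set.range fun y : Y₁ => fun g : G => (∑ c, p₁ c) (g • y))) =
      ∑ c, Module.finrank ℚ ↥(Submodule.span ℚ (Set.range fun y : Y₁ => fun g : G => p₁ c (g • y))) := by
    rw [hself]
    exact Finset.sum_congr rfl fun c _ => by rw [inf_idem]
  haveI : ∀ c, FiniteDimensional ℚ ↥(Submodule.span ℚ (Set.range fun y : Y₁ => fun g : G => p₁ c (g • y))) :=
    fun c => FiniteDimensional.span_of_finite ℚ (Set.finite_range _)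
  haveI : FiniteDimensional ℚ ↥(Submodule.span ℚ (Set.range fun y : Y₁ => fun g : G => (∑ c, p₁ c) (g • y))) :=
    FiniteDimensional.span_of_finite ℚ (Set.finite_range _)
  have hle : ∀ c ∈ (Finset.univ : Finset C),
      Module.finrank ℚ ↥(Submodule.span ℚ (Set.range fun y : Y₀ => fun g : G => p₀ c (g • y)) ⊓
          Submodule.span ℚ (Set.range fun y : Y₁ => fun g : G => p₁ c (g • y))) ≤
        Module.finrank ℚ ↥(Submodule.span ℚ (Set.range fun y : Y₁ => fun g : G => p₁ c (g • y))) :=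
    fun c _ => Submodule.finrank_mono inf_le_right
  constructor
  · intro hS c
    have heq : Module.finrank ℚ ↥(Submodule.span ℚ (Set.range fun y : Y₀ => fun g : G => (∑ c, p₀ c) (g • y)) ⊓
        Submodule.span ℚ (Set.range fun y : Y₁ => fun g : G => (∑ c, p₁ c) (g • y))) =
        Module.finrank ℚ ↥(Submodule.span ℚ (Set.range fun y : Y₁ => fun g : G => (∑ c, p₁ c) (g • y))) := by
      rw [inf_eq_right.2 hS]
    rw [hmeet, hself] at heq
    exact inf_eq_right.1 (Submodule.eq_of_le_of_finrank_eq inf_le_right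
      ((Finset.sum_eq_sum_iff_of_le hle).1 heq c (Finset.mem_univ c)))
  · intro hS
    have heq : Module.finrank ℚ ↥(Submodule.span ℚ (Set.range fun y : Y₀ => fun g : G => (∑ c, p₀ c) (g • y)) ⊓
        Submodule.span ℚ (Set.range fun y : Y₁ => fun g : G => (∑ c, p₁ c) (g • y))) =
        Module.finrank ℚ ↥(Submodule.span ℚ (Set.range fun y : Y₁ => fun g : G => (∑ c, p₁ c) (g • y))) := by
      rw [hmeet, hself]
      exact Finset.sum_congr rfl fun c _ => by rw [inf_eq_right.2 (hS c)]
    exact inf_eq_right.1 (Submodule.eq_of_le_of_finrank_eq inf_le_right heq)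

/-- **EQUALITY SPLITS OVER THE CLASSES: `S(Σ_c p¹_c) = S(Σ_c p⁰_c) ⟺ ∀ c, S(p¹_c) = S(p⁰_c)`** (same setting).
[cite: Serre1977, §2.6] [cite: Gordon1999HodgeAVSurvey, §3 Theorem (proof), 7.5–7.7] -/
theorem span_shadowCoeff_sum_eq_iff_forall_of_classes {C : Type u} [Fintype C] {J₀ : Type u₀} {J₁ : Type u₁}
    [Fintype J₀] [Fintype J₁] (c₀ : J₀ → C) (c₁ : J₁ → C)
    {A₀ : J₀ → Submodule ℚ (Y₀ → ℚ)} {A₁ : J₁ → Submodule ℚ (Y₁ → ℚ)}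
    (hA₀st : ∀ (j : J₀) (k : G) (a : Y₀ → ℚ), a ∈ A₀ j → (fun y => a (k • y)) ∈ A₀ j)
    (hA₀irr : ∀ (j : J₀) (W : Submodule ℚ (Y₀ → ℚ)), W ≤ A₀ j → W ≠ ⊥ →
      (∀ (k : G) (f : Y₀ → ℚ), f ∈ W → (fun y => f (k • y)) ∈ W) → W = A₀ j)
    (hA₁st : ∀ (j : J₁) (k : G) (a : Y₁ → ℚ), a ∈ A₁ j → (fun y => a (k • y)) ∈ A₁ j)
    (hA₁irr : ∀ (j : J₁) (W : Submodule ℚ (Y₁ → ℚ)), W ≤ A₁ j → W ≠ ⊥ →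
      (∀ (k : G) (f : Y₁ → ℚ), f ∈ W → (fun y => f (k • y)) ∈ W) → W = A₁ j)
    (h₀₀ : ∀ (j k : J₀) (L : (Y₀ → ℚ) →ₗ[ℚ] (Y₀ → ℚ)), c₀ j ≠ c₀ k → A₀ j ≠ ⊥ → (∀ a ∈ A₀ j, L a ∈ A₀ k) →
      (∀ a ∈ A₀ j, L a = 0 → a = 0) → (∀ (g : G) (a : Y₀ → ℚ), a ∈ A₀ j →
        L (fun y => a (g • y)) = fun y => L a (g • y)) → False)
    (h₀₁ : ∀ (j : J₀) (k : J₁) (L : (Y₀ → ℚ) →ₗ[ℚ] (Y₁ → ℚ)), c₀ j ≠ c₁ k → A₀ j ≠ ⊥ → (∀ a ∈ A₀ j, L a ∈ A₁ k) →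
      (∀ a ∈ A₀ j, L a = 0 → a = 0) → (∀ (g : G) (a : Y₀ → ℚ), a ∈ A₀ j →
        L (fun y => a (g • y)) = fun y => L a (g • y)) → False)
    (h₁₀ : ∀ (j : J₁) (k : J₀) (L : (Y₁ → ℚ) →ₗ[ℚ] (Y₀ → ℚ)), c₁ j ≠ c₀ k → A₁ j ≠ ⊥ → (∀ a ∈ A₁ j, L a ∈ A₀ k) →
      (∀ a ∈ A₁ j, L a = 0 → a = 0) → (∀ (g : G) (a : Y₁ → ℚ), a ∈ A₁ j →
        L (fun y => a (g • y)) = fun y => L a (g • y)) → False)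
    (h₁₁ : ∀ (j k : J₁) (L : (Y₁ → ℚ) →ₗ[ℚ] (Y₁ → ℚ)), c₁ j ≠ c₁ k → A₁ j ≠ ⊥ → (∀ a ∈ A₁ j, L a ∈ A₁ k) →
      (∀ a ∈ A₁ j, L a = 0 → a = 0) → (∀ (g : G) (a : Y₁ → ℚ), a ∈ A₁ j →
        L (fun y => a (g • y)) = fun y => L a (g • y)) → False)
    {p₀ : C → (Y₀ → ℚ)} {p₁ : C → (Y₁ → ℚ)}
    (hp₀ : ∀ c, p₀ c ∈ ⨆ j : {j // c₀ j = c}, A₀ j.1) (hp₁ : ∀ c, p₁ c ∈ ⨆ j : {j // c₁ j = c}, A₁ j.1) :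
    Submodule.span ℚ (Set.range fun y : Y₁ => fun g : G => (∑ c, p₁ c) (g • y)) =
        Submodule.span ℚ (Set.range fun y : Y₀ => fun g : G => (∑ c, p₀ c) (g • y)) ↔
      ∀ c, Submodule.span ℚ (Set.range fun y : Y₁ => fun g : G => p₁ c (g • y)) =
        Submodule.span ℚ (Set.range fun y : Y₀ => fun g : G => p₀ c (g • y)) := by
  have h10 := span_shadowCoeff_sum_le_iff_forall_of_classes c₀ c₁ hA₀st hA₀irr hA₁st hA₁irr h₀₀ h₀₁ h₁₀ h₁₁ hp₀ hp₁
  have h01 := span_shadowCoeff_sum_le_iff_forall_of_classes c₁ c₀ hA₁st hA₁irr hA₀st hA₀irr h₁₁ h₁₀ h₀₁ h₀₀ hp₁ hp₀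
  simp only [le_antisymm_iff, h10, h01, ← forall_and]

/-! ### §2 Type ranks -/

section TypeRanks

variable {I : Type u'} {E : I → Type v} [∀ i, MulAction G (E i)] [∀ i, Fintype (E i)] [Fintype I]
  [∀ i, Nonempty (E i)]

/-- **HODGE DOMINATION IS DECIDED CLASS BY CLASS (type ranks).**  Slot `0` with an equivariant pivot
`r₀ : E₀ → Y₀` refining the trace classes and shadow `w₀ = Σ_c p⁰_c`; slot `1` with its type vector
`u₁ = Σ_c p¹_c` decomposed in `ℚ^{E₁}` itself; labelled constituents as in §1.  Then
**`rank(Φ₀,Φ₁) = rank Φ₀ ⟺ ∀ c, S(p¹_c) ≤ S(p⁰_c)`** — `A₁` is Hodge-dominated by `A₀` iff it is so in every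
isotypic class (file K3: `⟺ MC₁ ≤ S(w₀)`; inside a class assembled from a reference irreducible, file C6 reads
`S(p¹_c) ≤ S(p⁰_c)` as `D⟨b′⟩ ≤ D⟨b⟩`). [cite: Gordon1999HodgeAVSurvey, §3 Theorem (proof), 7.5–7.7 and 9.4.3]
[cite: Deligne1982HodgeCycles, I.5 (p. 53)] [cite: Serre1977, §2.6] -/
theorem typeRank_sigmaType_eq_typeRank_iff_forall_of_classes {ρ : G} {Φ : ∀ i, Set (E i)}
    (h : ∀ i, IsCMTypeWith ρ (Φ i)) {i₀ i₁ : I} (hI : ∀ j, j = i₀ ∨ j = i₁)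
    (r₀ : E i₀ → Y₀) (hr₀ : ∀ (g : G) (x : E i₀), r₀ (g • x) = g • r₀ x)
    (hfine₀ : ∀ x x' : E i₀, r₀ x = r₀ x' → ∃ n : G, (∀ y : E i₁, n • y = y) ∧ n • x = x')
    {C : Type u} [Fintype C] {J₀ : Type u₀} {J₁ : Type u₁} [Fintype J₀] [Fintype J₁] (c₀ : J₀ → C) (c₁ : J₁ → C)
    {A₀ : J₀ → Submodule ℚ (Y₀ → ℚ)} {A₁ : J₁ → Submodule ℚ (E i₁ → ℚ)}
    (hA₀st : ∀ (j : J₀) (k : G) (a : Y₀ → ℚ), a ∈ A₀ j → (fun y => a (k • y)) ∈ A₀ j)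
    (hA₀irr : ∀ (j : J₀) (W : Submodule ℚ (Y₀ → ℚ)), W ≤ A₀ j → W ≠ ⊥ →
      (∀ (k : G) (f : Y₀ → ℚ), f ∈ W → (fun y => f (k • y)) ∈ W) → W = A₀ j)
    (hA₁st : ∀ (j : J₁) (k : G) (a : E i₁ → ℚ), a ∈ A₁ j → (fun y => a (k • y)) ∈ A₁ j)
    (hA₁irr : ∀ (j : J₁) (W : Submodule ℚ (E i₁ → ℚ)), W ≤ A₁ j → W ≠ ⊥ →
      (∀ (k : G) (f : E i₁ → ℚ), f ∈ W → (fun y => f (k • y)) ∈ W) → W = A₁ j)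
    (h₀₀ : ∀ (j k : J₀) (L : (Y₀ → ℚ) →ₗ[ℚ] (Y₀ → ℚ)), c₀ j ≠ c₀ k → A₀ j ≠ ⊥ → (∀ a ∈ A₀ j, L a ∈ A₀ k) →
      (∀ a ∈ A₀ j, L a = 0 → a = 0) → (∀ (g : G) (a : Y₀ → ℚ), a ∈ A₀ j →
        L (fun y => a (g • y)) = fun y => L a (g • y)) → False)
    (h₀₁ : ∀ (j : J₀) (k : J₁) (L : (Y₀ → ℚ) →ₗ[ℚ] (E i₁ → ℚ)), c₀ j ≠ c₁ k → A₀ j ≠ ⊥ →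
      (∀ a ∈ A₀ j, L a ∈ A₁ k) → (∀ a ∈ A₀ j, L a = 0 → a = 0) → (∀ (g : G) (a : Y₀ → ℚ), a ∈ A₀ j →
        L (fun y => a (g • y)) = fun y => L a (g • y)) → False)
    (h₁₀ : ∀ (j : J₁) (k : J₀) (L : (E i₁ → ℚ) →ₗ[ℚ] (Y₀ → ℚ)), c₁ j ≠ c₀ k → A₁ j ≠ ⊥ →
      (∀ a ∈ A₁ j, L a ∈ A₀ k) → (∀ a ∈ A₁ j, L a = 0 → a = 0) → (∀ (g : G) (a : E i₁ → ℚ), a ∈ A₁ j →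
        L (fun y => a (g • y)) = fun y => L a (g • y)) → False)
    (h₁₁ : ∀ (j k : J₁) (L : (E i₁ → ℚ) →ₗ[ℚ] (E i₁ → ℚ)), c₁ j ≠ c₁ k → A₁ j ≠ ⊥ → (∀ a ∈ A₁ j, L a ∈ A₁ k) →
      (∀ a ∈ A₁ j, L a = 0 → a = 0) → (∀ (g : G) (a : E i₁ → ℚ), a ∈ A₁ j →
        L (fun y => a (g • y)) = fun y => L a (g • y)) → False)
    {p₀ : C → (Y₀ → ℚ)} {p₁ : C → (E i₁ → ℚ)}
    (hp₀ : ∀ c, p₀ c ∈ ⨆ j : {j // c₀ j = c}, A₀ j.1) (hp₁ : ∀ c, p₁ c ∈ ⨆ j : {j // c₁ j = c}, A₁ j.1)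
    (hw₀ : (fun y : Y₀ => ∑ x ∈ Finset.univ.filter (fun x => r₀ x = y), antiVec (Φ i₀) (1 : G) x) = ∑ c, p₀ c)
    (hu₁ : antiVec (Φ i₁) (1 : G) = ∑ c, p₁ c) :
    typeRank G (sigmaType Φ) = typeRank G (Φ i₀) ↔
      ∀ c, Submodule.span ℚ (Set.range fun y : E i₁ => fun g : G => p₁ c (g • y)) ≤
        Submodule.span ℚ (Set.range fun y : Y₀ => fun g : G => p₀ c (g • y)) := by
  have e₀ : (fun (y : Y₀) (g : G) => ∑ x ∈ Finset.univ.filter (fun x => r₀ x = g • y), antiVec (Φ i₀) (1 : G) x) =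
      fun (y : Y₀) (g : G) => (∑ c, p₀ c) (g • y) := by
    funext y g
    exact congrFun hw₀ (g • y)
  rw [typeRank_sigmaType_eq_typeRank_iff_span_coeff_le_span_shadowCoeff_of_fine h hI r₀ hr₀ hfine₀,
    span_coeff_eq_span_shadowCoeff_of_eq Φ i₁ hu₁, e₀]
  exact span_shadowCoeff_sum_le_iff_forall_of_classes c₀ c₁ hA₀st hA₀irr hA₁st hA₁irr h₀₀ h₀₁ h₁₀ h₁₁ hp₀ hp₁

omit [Fintype Y₀] [Fintype Y₁] in
/-- **A CLASS MET BY `u₁` BUT MISSED BY `w₀` FORBIDS DOMINATION**: if some class component `p¹_c ≠ 0` while `p⁰_c = 0`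
then `S(p¹_c) ≰ S(p⁰_c) = 0`, so `rank(Φ₀,Φ₁) > rank Φ₀` by the class-by-class criterion.  (The coefficient space of a
non-zero vector is non-zero: it contains `g ↦ p(g·y)` with `p(y) ≠ 0`.) [cite: Serre1977, §2.6]
[cite: Gordon1999HodgeAVSurvey, 7.5–7.7] -/
theorem not_span_shadowCoeff_le_of_ne_zero_of_eq_zero {p₀ : Y₀ → ℚ} {p₁ : Y₁ → ℚ} (hp₁ : p₁ ≠ 0)
    (hp₀ : p₀ = 0) :
    ¬ Submodule.span ℚ (Set.range fun y : Y₁ => fun g : G => p₁ (g • y)) ≤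
        Submodule.span ℚ (Set.range fun y : Y₀ => fun g : G => p₀ (g • y)) := by
  intro hle
  apply hp₁
  funext y
  have hzero : Submodule.span ℚ (Set.range fun y : Y₀ => fun g : G => p₀ (g • y)) = ⊥ := by
    rw [Submodule.span_eq_bot]
    rintro _ ⟨y', rfl⟩
    funext g
    simp [hp₀]
  have hmem : (fun g : G => p₁ (g • y)) ∈ Submodule.span ℚ (Set.range fun y : Y₁ => fun g : G => p₁ (g • y)) :=
    Submodule.subset_span ⟨y, rfl⟩
  have h := hle hmem
  rw [hzero, Submodule.mem_bot] at h
  have h1 := congrFun h (1 : G)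
  simpa using h1

end TypeRanks

end Summit.HodgeConjecture.CorCM.IrrOdd

/-! ### §3 CM fields -/

namespace Summit.HodgeConjecture.CorCM

open CategoryTheory CategoryTheory.Limits NumberField Module IntermediateField
open Literature.NumberTheory.ComplexMultiplication
open Literature.AlgebraicGeometry.Motives (AbelianVariety CMType)
open Literature.AlgebraicGeometry.Motives.AbelianVariety
open Literature.AlgebraicGeometry.HodgeTheory
open Literature.AlgebraicGeometry.ComplexMultiplication (IsCMTypeRealisation)
open Literature.AlgebraicGeometry.Pohlmann1968

variable {I : Type} [Fintype I] {K : I → Type} [∀ i, Field (K i)] [∀ i, NumberField (K i)] [∀ i, IsCMField (K i)]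
  {T₀ : Type} [Field T₀] [NumberField T₀]

/-- **HODGE DOMINATION IS DECIDED CLASS BY CLASS (CM fields).**  `T₀ ⊆ K_{i₀}` a subfield containing the traces
(TR), shadow `w₀ = Σ_c p⁰_c` of `Φ₀` on `Hom(T₀, ℂ)`, type vector `u₁ = Σ_c p¹_c` of `Φ₁` on `Hom(K_{i₁}, ℂ)`,
class components along labelled `Aut(ℂ)`-stable irreducible constituents with no equivariant embedding across labels.
Then **`cmFamilyRank Φ = cmTypeRank Φ₀` (`MT(A₀ × A₁) → MT(A₀)` an isogeny) `⟺ ∀ c, S(p¹_c) ≤ S(p⁰_c)`**.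
[cite: Gordon1999HodgeAVSurvey, §3 Theorem (proof), 7.5–7.7 and 9.4.3] [cite: Deligne1982HodgeCycles, I.5 (p. 53)]
[cite: Serre1977, §2.6] -/
theorem cmFamilyRank_eq_cmTypeRank_iff_forall_of_classes {i₀ i₁ : I} (hI : ∀ l, l = i₀ ∨ l = i₁)
    (Φ : ∀ i, CMType (K i)) [Algebra T₀ (K i₀)]
    (htr₀ : ∀ (a : K i₀ →+* ℂ) (k : K i₀), a k ∈ normalClosure ℚ (K i₁) ℂ → k ∈ Set.range (algebraMap T₀ (K i₀)))
    {C : Type} [Fintype C] {J₀ J₁ : Type} [Fintype J₀] [Fintype J₁] (c₀ : J₀ → C) (c₁ : J₁ → C)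
    {A₀ : J₀ → Submodule ℚ ((T₀ →+* ℂ) → ℚ)} {A₁ : J₁ → Submodule ℚ ((K i₁ →+* ℂ) → ℚ)}
    (hA₀st : ∀ (j : J₀) (k : ℂ ≃+* ℂ) (a : (T₀ →+* ℂ) → ℚ), a ∈ A₀ j → (fun y => a (k • y)) ∈ A₀ j)
    (hA₀irr : ∀ (j : J₀) (W : Submodule ℚ ((T₀ →+* ℂ) → ℚ)), W ≤ A₀ j → W ≠ ⊥ →
      (∀ (k : ℂ ≃+* ℂ) (f : (T₀ →+* ℂ) → ℚ), f ∈ W → (fun y => f (k • y)) ∈ W) → W = A₀ j)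
    (hA₁st : ∀ (j : J₁) (k : ℂ ≃+* ℂ) (a : (K i₁ →+* ℂ) → ℚ), a ∈ A₁ j → (fun y => a (k • y)) ∈ A₁ j)
    (hA₁irr : ∀ (j : J₁) (W : Submodule ℚ ((K i₁ →+* ℂ) → ℚ)), W ≤ A₁ j → W ≠ ⊥ →
      (∀ (k : ℂ ≃+* ℂ) (f : (K i₁ →+* ℂ) → ℚ), f ∈ W → (fun y => f (k • y)) ∈ W) → W = A₁ j)
    (h₀₀ : ∀ (j k : J₀) (L : ((T₀ →+* ℂ) → ℚ) →ₗ[ℚ] ((T₀ →+* ℂ) → ℚ)), c₀ j ≠ c₀ k → A₀ j ≠ ⊥ →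
      (∀ a ∈ A₀ j, L a ∈ A₀ k) → (∀ a ∈ A₀ j, L a = 0 → a = 0) → (∀ (g : ℂ ≃+* ℂ) (a : (T₀ →+* ℂ) → ℚ), a ∈ A₀ j →
        L (fun y => a (g • y)) = fun y => L a (g • y)) → False)
    (h₀₁ : ∀ (j : J₀) (k : J₁) (L : ((T₀ →+* ℂ) → ℚ) →ₗ[ℚ] ((K i₁ →+* ℂ) → ℚ)), c₀ j ≠ c₁ k → A₀ j ≠ ⊥ →
      (∀ a ∈ A₀ j, L a ∈ A₁ k) → (∀ a ∈ A₀ j, L a = 0 → a = 0) → (∀ (g : ℂ ≃+* ℂ) (a : (T₀ →+* ℂ) → ℚ), a ∈ A₀ j →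
        L (fun y => a (g • y)) = fun y => L a (g • y)) → False)
    (h₁₀ : ∀ (j : J₁) (k : J₀) (L : ((K i₁ →+* ℂ) → ℚ) →ₗ[ℚ] ((T₀ →+* ℂ) → ℚ)), c₁ j ≠ c₀ k → A₁ j ≠ ⊥ →
      (∀ a ∈ A₁ j, L a ∈ A₀ k) → (∀ a ∈ A₁ j, L a = 0 → a = 0) → (∀ (g : ℂ ≃+* ℂ) (a : (K i₁ →+* ℂ) → ℚ), a ∈ A₁ j →
        L (fun y => a (g • y)) = fun y => L a (g • y)) → False)
    (h₁₁ : ∀ (j k : J₁) (L : ((K i₁ →+* ℂ) → ℚ) →ₗ[ℚ] ((K i₁ →+* ℂ) → ℚ)), c₁ j ≠ c₁ k → A₁ j ≠ ⊥ →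
      (∀ a ∈ A₁ j, L a ∈ A₁ k) → (∀ a ∈ A₁ j, L a = 0 → a = 0) → (∀ (g : ℂ ≃+* ℂ) (a : (K i₁ →+* ℂ) → ℚ), a ∈ A₁ j →
        L (fun y => a (g • y)) = fun y => L a (g • y)) → False)
    {p₀ : C → ((T₀ →+* ℂ) → ℚ)} {p₁ : C → ((K i₁ →+* ℂ) → ℚ)}
    (hp₀ : ∀ c, p₀ c ∈ ⨆ j : {j // c₀ j = c}, A₀ j.1) (hp₁ : ∀ c, p₁ c ∈ ⨆ j : {j // c₁ j = c}, A₁ j.1)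
    (hw₀ : (fun y : T₀ →+* ℂ => ∑ t ∈ Finset.univ.filter (fun t : K i₀ →+* ℂ => t.comp (algebraMap T₀ (K i₀)) = y),
        antiVec (Φ i₀).1 (1 : ℂ ≃+* ℂ) t) = ∑ c, p₀ c)
    (hu₁ : antiVec (Φ i₁).1 (1 : ℂ ≃+* ℂ) = ∑ c, p₁ c) :
    CMAlgebra.cmFamilyRank Φ = cmTypeRank (Φ i₀) ↔
      ∀ c, Submodule.span ℚ (Set.range fun y : K i₁ →+* ℂ => fun g : ℂ ≃+* ℂ => p₁ c (g • y)) ≤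
        Submodule.span ℚ (Set.range fun y : T₀ →+* ℂ => fun g : ℂ ≃+* ℂ => p₀ c (g • y)) := by
  haveI : ∀ i, Nonempty (K i →+* ℂ) := fun i => inferInstance
  exact IrrOdd.typeRank_sigmaType_eq_typeRank_iff_forall_of_classes (G := ℂ ≃+* ℂ) (E := fun i => K i →+* ℂ)
    (Φ := fun i => (Φ i).1) (fun i => isCMTypeWith_conj (Φ i)) hI
    (fun t : K i₀ →+* ℂ => t.comp (algebraMap T₀ (K i₀))) (fun _ _ => rfl)
    (exists_stab_smul_eq_of_comp_eq_of_trace_le i₁ htr₀) c₀ c₁ hA₀st hA₀irr hA₁st hA₁irr h₀₀ h₀₁ h₁₀ h₁₁ hp₀ hp₁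
    hw₀ hu₁

end Summit.HodgeConjecture.CorCM

end
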